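import Summits.ValiantsHypothesis.ValiantsHypothesis.Theorems.ImmanantSliceEvenCycleDominanceBlocks

/-!
# Route ImmanantSlice — the class sum `classSumA (2j)` is non-zero (a parity proof)

`classSumA r = Σ_{τ ∈ S_r} [τ admits an alternating colouring] · sign τ` (the class sum of the
all-ones-return reduction `per ≤ D^even`, `ImmanantSliceEvenCycleDominanceBlocks.lean`). On paper
`classSumA (2j) = −(2j−1)!!(2j−3)!!`; here we only prove what the reduction needs, `classSumA (2j) ≠ 0`,
by PARITY: the number of colourable permutations of `Fin (2j)` is odd, hence the signed count cannot
vanish. Oddness by two involution arguments (`card_filter_fixed_mod_two`: a finite set with an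
involution has as many points as fixed points, mod 2):
* `τ ↦ τ⁻¹` on colourable permutations: the fixed points are the colourable involutions = the
  fixed-point-free involutions (`filter_colourable_inv_eq`);
* on fixed-point-free involutions, conjugation by the transposition `(2k, 2k+1)` fixes exactly those
  with `ι(2k) = 2k+1` (`conj_swap_eq_iff`); iterating over `k < j` ends at the single involution
  `(0 1)(2 3)⋯` (`card_stage_last`).

* `classSumA_ne_zero : classSumA (j * 2) ≠ 0`.

Honest framing: elementary counting; nothing here bears on VP ≠ VNP.
-/

set_option linter.dupNamespace false

noncomputable section

namespace Summit.ValiantsHypothesis.ValiantsHypothesis.Theorems.ImmanantSlice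

open Equiv Finset

/-! ## Involutions and parity -/

/-- A finite set carrying an involution has as many elements as fixed points, modulo `2`.
[folklore] -/
theorem card_filter_fixed_mod_two {α : Type*} [DecidableEq α] (s : Finset α) (g : α → α)
    (hmem : ∀ a ∈ s, g a ∈ s) (hinv : ∀ a ∈ s, g (g a) = a) :
    ((s.filter fun a => g a = a).card : ZMod 2) = (s.card : ZMod 2) := by
  classical
  rw [← Finset.card_filter_add_card_filter_not (s := s) (fun a => g a = a)]
  push_cast
  suffices h : ((s.filter fun a => ¬ g a = a).card : ZMod 2) = 0 by rw [h, add_zero]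
  rw [Finset.card_eq_sum_ones, Nat.cast_sum]
  simp only [Nat.cast_one]
  refine Finset.sum_involution (fun a _ => g a) (fun a _ => by decide)
    (fun a ha _ => (Finset.mem_filter.1 ha).2) (fun a ha => ?_)
    (fun a ha => hinv a (Finset.mem_filter.1 ha).1)
  obtain ⟨has, hne⟩ := Finset.mem_filter.1 ha
  refine Finset.mem_filter.2 ⟨hmem a has, fun h => hne ?_⟩
  rw [hinv a has] at h
  exact h.symm

/-! ## Colourable permutations and fixed-point-free involutions -/

/-- Colourability is invariant under inversion. [folklore] -/
theorem colourable_inv_iff {r : ℕ} (τ : Perm (Fin r)) :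
    (∃ d : Fin r → Bool, ∀ j, d (τ⁻¹ j) = !d j) ↔ ∃ d : Fin r → Bool, ∀ j, d (τ j) = !d j := by
  constructor
  · rintro ⟨d, hd⟩
    refine ⟨d, fun j => ?_⟩
    have := hd (τ j)
    rw [show τ⁻¹ (τ j) = j from τ.symm_apply_apply j] at this
    rw [this, Bool.not_not]
  · rintro ⟨d, hd⟩
    refine ⟨d, fun j => ?_⟩
    have := hd (τ⁻¹ j)
    rw [show τ (τ⁻¹ j) = j from τ.apply_symm_apply j] at this
    rw [this, Bool.not_not]

/-- A fixed-point-free involution is colourable: colour `x` by `x < ι x`. [folklore] -/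
theorem colourable_of_fpf_involution {r : ℕ} (ι : Perm (Fin r)) (h : ∀ x, ι x ≠ x ∧ ι (ι x) = x) :
    ∃ d : Fin r → Bool, ∀ j, d (ι j) = !d j := by
  refine ⟨fun x => decide (x < ι x), fun j => ?_⟩
  obtain ⟨hne, hinv⟩ := h j
  show decide (ι j < ι (ι j)) = !decide (j < ι j)
  rw [hinv]
  rcases lt_or_gt_of_ne hne with hlt | hgt
  · simp [hlt, not_lt.2 hlt.le]
  · simp [hgt, not_lt.2 hgt.le]

/-- The colourable involutions are exactly the fixed-point-free involutions. [folklore] -/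
theorem filter_colourable_inv_eq (r : ℕ) :
    ((Finset.univ.filter fun τ : Perm (Fin r) => ∃ d : Fin r → Bool, ∀ j, d (τ j) = !d j).filter
        fun τ => τ⁻¹ = τ) =
      Finset.univ.filter fun ι : Perm (Fin r) => ∀ x, ι x ≠ x ∧ ι (ι x) = x := by
  ext τ
  simp only [Finset.mem_filter, Finset.mem_univ, true_and]
  constructor
  · rintro ⟨⟨d, hd⟩, hinv⟩ x
    refine ⟨fun hx => ?_, ?_⟩
    · have := hd x; rw [hx] at this; cases d x <;> simp at this
    · have := congrArg (fun g : Perm (Fin r) => g (τ x)) hinv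
      have h2 : x = τ (τ x) := by simpa using this
      exact h2.symm
  · intro h
    refine ⟨colourable_of_fpf_involution τ h, ?_⟩
    refine Equiv.Perm.ext fun x => ?_
    rw [Perm.inv_def, Equiv.symm_apply_eq]
    exact (h x).2.symm

/-- **Parity transfer 1**: `#colourable ≡ #fixed-point-free involutions (mod 2)`. [folklore] -/
theorem card_colourable_mod_two (r : ℕ) :
    ((Finset.univ.filter fun τ : Perm (Fin r) => ∃ d : Fin r → Bool, ∀ j, d (τ j) = !d j).card :
        ZMod 2) =
      ((Finset.univ.filter fun ι : Perm (Fin r) => ∀ x, ι x ≠ x ∧ ι (ι x) = x).card : ZMod 2) := by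
  classical
  rw [← filter_colourable_inv_eq, card_filter_fixed_mod_two _ (fun τ => τ⁻¹)]
  · intro τ hτ
    simp only [Finset.mem_filter, Finset.mem_univ, true_and] at hτ ⊢
    exact (colourable_inv_iff τ).2 hτ
  · intro τ _; exact inv_inv τ

/-! ## Fixed-point-free involutions: iterated conjugation by the transpositions `(2k, 2k+1)` -/

/-- For a fixed-point-free involution `ι` and `a ≠ b`: `ι` commutes with the transposition `(a b)`
iff `ι a = b`. [folklore] -/
theorem conj_swap_eq_iff {r : ℕ} (ι : Perm (Fin r)) (h : ∀ x, ι x ≠ x ∧ ι (ι x) = x) {a b : Fin r}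
    (hab : a ≠ b) : swap a b * ι * swap a b = ι ↔ ι a = b := by
  constructor
  · intro hc
    have h1 := congrArg (fun g : Perm (Fin r) => g a) hc
    simp only [Perm.mul_apply, swap_apply_left] at h1
    -- `h1 : swap a b (ι b) = ι a`
    by_contra hne
    have hιa : ι a ≠ a := (h a).1
    have hsa : swap a b (ι a) = ι a := swap_apply_of_ne_of_ne hιa hne
    -- then `ι b = ι a`
    have : ι b = ι a := by
      have := congrArg (swap a b) h1
      rw [swap_apply_self, hsa] at this
      exact this
    exact hab.symm (ι.injective this)
  · intro hιa
    have hιb : ι b = a := by rw [← hιa]; exact (h a).2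
    ext x
    simp only [Perm.mul_apply]
    by_cases hxa : x = a
    · subst hxa; rw [swap_apply_left, hιb, swap_apply_left, hιa]
    by_cases hxb : x = b
    · subst hxb; rw [swap_apply_right, hιa, swap_apply_right, hιb]
    rw [swap_apply_of_ne_of_ne hxa hxb]
    have h1 : ι x ≠ a := fun hx => hxb (by rw [← (h x).2, hx, hιa])
    have h2 : ι x ≠ b := fun hx => hxa (by rw [← (h x).2, hx, hιb])
    rw [swap_apply_of_ne_of_ne h1 h2]

/-- The points `2i` and `2i+1` of `Fin (j * 2)` are distinct. [folklore] -/
theorem pair_ne (j : ℕ) (i : Fin j) :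
    finProdFinEquiv (i, (0 : Fin 2)) ≠ finProdFinEquiv (i, (1 : Fin 2)) := by
  intro h
  have := finProdFinEquiv.injective h
  simp at this

/-- **Parity transfer 2**: among the fixed-point-free involutions with `ι(2i) = 2i+1` for `i < k`,
those with moreover `ι(2k) = 2k+1` are the fixed points of conjugation by `(2k, 2k+1)`; so the two
counts agree modulo `2`. [folklore] -/
theorem card_stage_mod_two (j : ℕ) (k : ℕ) (hk : k < j) :
    ((Finset.univ.filter fun ι : Perm (Fin (j * 2)) => (∀ x, ι x ≠ x ∧ ι (ι x) = x) ∧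
        ∀ i : Fin j, (i : ℕ) < k + 1 →
          ι (finProdFinEquiv (i, (0 : Fin 2))) = finProdFinEquiv (i, (1 : Fin 2))).card : ZMod 2) =
      ((Finset.univ.filter fun ι : Perm (Fin (j * 2)) => (∀ x, ι x ≠ x ∧ ι (ι x) = x) ∧
        ∀ i : Fin j, (i : ℕ) < k →
          ι (finProdFinEquiv (i, (0 : Fin 2))) = finProdFinEquiv (i, (1 : Fin 2))).card : ZMod 2) := by
  classical
  set a : Fin (j * 2) := finProdFinEquiv ((⟨k, hk⟩ : Fin j), (0 : Fin 2)) with ha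
  set b : Fin (j * 2) := finProdFinEquiv ((⟨k, hk⟩ : Fin j), (1 : Fin 2)) with hb
  have hab : a ≠ b := pair_ne j ⟨k, hk⟩
  set S := (Finset.univ.filter fun ι : Perm (Fin (j * 2)) => (∀ x, ι x ≠ x ∧ ι (ι x) = x) ∧
    ∀ i : Fin j, (i : ℕ) < k →
      ι (finProdFinEquiv (i, (0 : Fin 2))) = finProdFinEquiv (i, (1 : Fin 2))) with hS
  -- the swap fixes the earlier pairs
  have hfix : ∀ (i : Fin j), (i : ℕ) < k → ∀ c : Fin 2,
      swap a b (finProdFinEquiv (i, c)) = finProdFinEquiv (i, c) := by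
    intro i hi c
    apply swap_apply_of_ne_of_ne
    · intro h
      have h' : (i : ℕ) = k := congrArg Fin.val (Prod.ext_iff.mp (finProdFinEquiv.injective h)).1
      omega
    · intro h
      have h' : (i : ℕ) = k := congrArg Fin.val (Prod.ext_iff.mp (finProdFinEquiv.injective h)).1
      omega
  rw [← card_filter_fixed_mod_two S (fun ι => swap a b * ι * swap a b)]
  · -- fixed points of the conjugation inside `S` = the next stage
    congr 1
    apply congrArg Finset.card
    ext ι
    constructor
    · intro hmem
      obtain ⟨-, hι, hnext⟩ := Finset.mem_filter.1 hmem
      refine Finset.mem_filter.2 ⟨?_, ?_⟩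
      · rw [hS]
        exact Finset.mem_filter.2 ⟨Finset.mem_univ _, hι, fun i hi => hnext i (Nat.lt_succ_of_lt hi)⟩
      · exact (conj_swap_eq_iff ι hι hab).2 (hnext ⟨k, hk⟩ (Nat.lt_succ_self k))
    · intro hmem
      obtain ⟨hιS, hc⟩ := Finset.mem_filter.1 hmem
      rw [hS] at hιS
      obtain ⟨-, hι, hprev⟩ := Finset.mem_filter.1 hιS
      refine Finset.mem_filter.2 ⟨Finset.mem_univ _, hι, fun i hi => ?_⟩
      rcases Nat.lt_succ_iff_lt_or_eq.1 hi with hi' | hi'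
      · exact hprev i hi'
      · have hik : i = ⟨k, hk⟩ := Fin.ext hi'
        subst hik
        exact (conj_swap_eq_iff ι hι hab).1 hc
  · -- the conjugation preserves `S`
    intro ι hιS
    rw [hS] at hιS ⊢
    obtain ⟨-, hι, hprev⟩ := Finset.mem_filter.1 hιS
    refine Finset.mem_filter.2 ⟨Finset.mem_univ _, fun x => ⟨?_, ?_⟩, fun i hi => ?_⟩
    · simp only [Perm.mul_apply]
      intro h
      have := congrArg (swap a b) h
      rw [swap_apply_self] at this
      exact (hι _).1 this
    · simp only [Perm.mul_apply, swap_apply_self]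
      rw [(hι _).2, swap_apply_self]
    · simp only [Perm.mul_apply]
      rw [hfix i hi 0, hprev i hi, hfix i hi 1]
  · -- it is an involution
    intro ι _
    ext x
    simp only [Perm.mul_apply, swap_apply_self]

/-- The last stage is the single involution `(0 1)(2 3)⋯`. [folklore] -/
theorem card_stage_last (j : ℕ) :
    (Finset.univ.filter fun ι : Perm (Fin (j * 2)) => (∀ x, ι x ≠ x ∧ ι (ι x) = x) ∧
        ∀ i : Fin j, (i : ℕ) < j →
          ι (finProdFinEquiv (i, (0 : Fin 2))) = finProdFinEquiv (i, (1 : Fin 2))).card = 1 := by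
  classical
  set ι₀ : Perm (Fin (j * 2)) := (finProdFinEquiv : Fin j × Fin 2 ≃ Fin (j * 2)).permCongr
    (Equiv.prodCongrRight fun _ : Fin j => swap (0 : Fin 2) 1) with hι₀
  have hι₀_apply : ∀ (i : Fin j) (c : Fin 2),
      ι₀ (finProdFinEquiv (i, c)) = finProdFinEquiv (i, swap (0 : Fin 2) 1 c) := by
    intro i c; simp [hι₀, Equiv.permCongr_apply]
  rw [Finset.card_eq_one]
  refine ⟨ι₀, ?_⟩
  ext ι
  simp only [Finset.mem_filter, Finset.mem_univ, true_and, Finset.mem_singleton]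
  constructor
  · rintro ⟨hι, hall⟩
    ext x
    obtain ⟨⟨i, c⟩, rfl⟩ := finProdFinEquiv.surjective x
    rw [hι₀_apply]
    fin_cases c
    · rw [show ((⟨0, by norm_num⟩ : Fin 2)) = 0 from rfl, hall i i.2, swap_apply_left]
    · rw [show ((⟨1, by norm_num⟩ : Fin 2)) = 1 from rfl, swap_apply_right, ← hall i i.2, (hι _).2]
  · rintro rfl
    refine ⟨fun x => ⟨?_, ?_⟩, fun i _ => by rw [hι₀_apply, swap_apply_left]⟩
    · obtain ⟨⟨i, c⟩, rfl⟩ := finProdFinEquiv.surjective x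
      rw [hι₀_apply]
      intro h
      have := finProdFinEquiv.injective h
      simp only [Prod.mk.injEq, true_and] at this
      fin_cases c <;> simp at this
    · obtain ⟨⟨i, c⟩, rfl⟩ := finProdFinEquiv.surjective x
      rw [hι₀_apply, hι₀_apply, swap_apply_self]

/-- The number of fixed-point-free involutions of `Fin (2j)` is odd. [folklore] -/
theorem card_fpf_involutions_mod_two (j : ℕ) :
    ((Finset.univ.filter fun ι : Perm (Fin (j * 2)) => ∀ x, ι x ≠ x ∧ ι (ι x) = x).card : ZMod 2)
      = 1 := by
  classical
  -- stage `k`: the involutions with `ι(2i) = 2i+1` for `i < k`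
  have hstage : ∀ k, k ≤ j →
      ((Finset.univ.filter fun ι : Perm (Fin (j * 2)) => (∀ x, ι x ≠ x ∧ ι (ι x) = x) ∧
        ∀ i : Fin j, (i : ℕ) < k →
          ι (finProdFinEquiv (i, (0 : Fin 2))) = finProdFinEquiv (i, (1 : Fin 2))).card : ZMod 2) =
      ((Finset.univ.filter fun ι : Perm (Fin (j * 2)) => ∀ x, ι x ≠ x ∧ ι (ι x) = x).card :
        ZMod 2) := by
    intro k
    induction k with
    | zero =>
      intro _
      congr 2
      ext ι
      simp
    | succ k ih =>
      intro hk
      rw [card_stage_mod_two j k (Nat.lt_of_succ_le hk)]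
      exact ih (Nat.le_of_succ_le hk)
  rw [← hstage j le_rfl, card_stage_last]
  simp

/-! ## The class sum -/

/-- **`classSumA (2j) ≠ 0`**: the signed count of colourable permutations of `Fin (2j)` is odd.
[folklore] -/
theorem classSumA_ne_zero (j : ℕ) : classSumA (j * 2) ≠ 0 := by
  classical
  intro h0
  rw [classSumA, ← Finset.sum_filter] at h0
  -- the integer version of the signed count
  have hZ : (∑ τ ∈ Finset.univ.filter (fun τ : Perm (Fin (j * 2)) =>
      ∃ d : Fin (j * 2) → Bool, ∀ i, d (τ i) = !d i), ((Perm.sign τ : ℤ) : ℂ)) =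
      (((∑ τ ∈ Finset.univ.filter (fun τ : Perm (Fin (j * 2)) =>
        ∃ d : Fin (j * 2) → Bool, ∀ i, d (τ i) = !d i), (Perm.sign τ : ℤ)) : ℤ) : ℂ) := by
    push_cast; rfl
  rw [hZ] at h0
  have hint : (∑ τ ∈ Finset.univ.filter (fun τ : Perm (Fin (j * 2)) =>
      ∃ d : Fin (j * 2) → Bool, ∀ i, d (τ i) = !d i), (Perm.sign τ : ℤ)) = 0 := by
    exact_mod_cast h0
  -- modulo 2 every sign is `1`
  have hmod : (((∑ τ ∈ Finset.univ.filter (fun τ : Perm (Fin (j * 2)) =>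
      ∃ d : Fin (j * 2) → Bool, ∀ i, d (τ i) = !d i), (Perm.sign τ : ℤ)) : ℤ) : ZMod 2) =
      ((Finset.univ.filter (fun τ : Perm (Fin (j * 2)) =>
        ∃ d : Fin (j * 2) → Bool, ∀ i, d (τ i) = !d i)).card : ZMod 2) := by
    rw [Int.cast_sum, Finset.card_eq_sum_ones, Nat.cast_sum]
    refine Finset.sum_congr rfl fun τ _ => ?_
    rcases Int.units_eq_one_or (Perm.sign τ) with h | h <;> rw [h] <;> decide
  rw [hint, card_colourable_mod_two, card_fpf_involutions_mod_two] at hmod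
  simp at hmod

end Summit.ValiantsHypothesis.ValiantsHypothesis.Theorems.ImmanantSlice
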